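import Literature.NumberTheory.Transcendental.PreBlochThird
import HarnessLib

/-!
# Unique divisibility of `P(F)` by every `n = 2ᵃ3ᵇ` (Dupont, Thm. 8.16, the part now proved)

NumberTheory/Transcendental proof file (no new definitions, no new named facts) for the named fact
`Literature.NumberTheory.Transcendental.Suslin1991_preBloch_isUniquelyDivisible`
(`PreBlochGroup.lean`; Dupont, *Scissors congruences, group homology and characteristic classes*
(2001), **Thm. 8.16**: "For `F` algebraically closed of characteristic zero `𝒫_F` is uniquely
divisible"). It assembles what the tree proves unconditionally along the printed proof:
`PreBloch.nsmul_surjective` (divisibility by every `n ≥ 1`, Cor. 8.15), `PreBloch.two_nsmul_injective`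
(Dupont's case `n = 2`, (8.17)) and `PreBloch.three_nsmul_injective` (the case `n = 3`,
`PreBlochThird.lean`), into

* `nsmul_injective_of_primeFactors`: injectivity of `n • (·)` from injectivity at the prime factors;
* **`nsmul_bijective_of_primeFactors_le_three`**: `n • (·)` is a bijection of `P(F)` for every
  `n ≥ 1` all of whose prime factors are `≤ 3`;
* `mem_closure_of_nsmul_mem_of_primeFactors_le_three`: the corresponding unconditional case of the
  fact's corollary `Suslin1991_preBloch_isUniquelyDivisible.mem_closure_of_nsmul_mem` (no torsion of
  order `2ᵃ3ᵇ` modulo the five-term relators).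

The general case (primes `p ≥ 5`) is Suslin's theorem (ICM 1986, Thm. 6.3) and is **not** proved in
the tree; see `PreBlochThird.lean` for why the elementary method stops at `p = 3`.

## References

* J. L. Dupont, *Scissors congruences, group homology and characteristic classes*, World
  Scientific 2001: Thm. 8.16 and its sketch proof, p. 43. [Dupont2001]
* A. A. Suslin, *Algebraic K-theory of fields*, Proc. ICM Berkeley 1986, vol. 1, 222–244: Thm. 6.3.
  [Suslin1986]
-/

noncomputable section

namespace Literature.NumberTheory.Transcendental

namespace PreBloch

variable {F : Type*} [Field F]

/-- Injectivity of `n • (·)` (`n ≥ 1`) follows from injectivity of `p • (·)` for the prime factors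
`p` of `n`. [folklore] -/
theorem nsmul_injective_of_primeFactors {M : Type*} [AddCommMonoid M] {n : ℕ} (hn : 0 < n)
    (h : ∀ p : ℕ, p.Prime → p ∣ n → Function.Injective fun a : M => p • a) :
    Function.Injective fun a : M => n • a := by
  induction n using Nat.strong_induction_on with
  | _ n IH =>
  rcases Nat.lt_or_ge n 2 with h1 | h2
  · have hn1 : n = 1 := by omega
    subst hn1
    intro a b hab
    simpa using hab
  · obtain ⟨p, hp, hpn⟩ := Nat.exists_prime_and_dvd (show n ≠ 1 by omega)
    obtain ⟨m, rfl⟩ := hpn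
    have hm : 0 < m := Nat.pos_of_mul_pos_left hn
    have hmn : m < p * m := by
      have := hp.one_lt
      nlinarith
    have hcomp : (fun a : M => (p * m) • a) = (fun a : M => p • a) ∘ fun a : M => m • a := by
      funext a
      simp only [Function.comp_apply, mul_comm p m, mul_nsmul]
    rw [hcomp]
    exact (h p hp (dvd_mul_right p m)).comp
      (IH m hmn hm fun q hq hqm => h q hq (dvd_mul_of_dvd_right hqm p))

/-- **Unique divisibility of `P(F)` by every `n = 2ᵃ3ᵇ`** (`F` algebraically closed of
characteristic `0`): `n • (·)` is a bijection of `P(F)` whenever all prime factors of `n ≥ 1` are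
`≤ 3` — divisibility (Cor. 8.15) with the cases `n = 2` ((8.17)) and `n = 3` (`PreBlochThird.lean`)
of the uniqueness in Thm. 8.16. [cite: Dupont2001, Thm. 8.16] -/
theorem nsmul_bijective_of_primeFactors_le_three [IsAlgClosed F] [CharZero F] {n : ℕ} (hn : 0 < n)
    (h3 : ∀ p : ℕ, p.Prime → p ∣ n → p ≤ 3) :
    Function.Bijective fun a : PreBloch F => n • a := by
  refine ⟨nsmul_injective_of_primeFactors hn fun p hp hpn => ?_, nsmul_surjective hn⟩
  have hle := h3 p hp hpn
  have hge := hp.two_le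
  obtain rfl | rfl : p = 2 ∨ p = 3 := by omega
  · exact two_nsmul_injective
  · exact three_nsmul_injective

/-- **No torsion of order `2ᵃ3ᵇ` modulo five-term relations**: for `F` algebraically closed of
characteristic `0` and `n ≥ 1` with all prime factors `≤ 3`, if `n • ξ` lies in the subgroup of
`ℤ⟨F ∖ {0,1}⟩` generated by the five-term relators then so does `ξ` (the unconditional part of
`Suslin1991_preBloch_isUniquelyDivisible.mem_closure_of_nsmul_mem`). [cite: Dupont2001, Thm. 8.16] -/
theorem mem_closure_of_nsmul_mem_of_primeFactors_le_three [IsAlgClosed F] [CharZero F] {n : ℕ}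
    (hn : 0 < n) (h3 : ∀ p : ℕ, p.Prime → p ∣ n → p ≤ 3) {ξ : FreeAbelianGroup (Gen F)}
    (hξ : n • ξ ∈ AddSubgroup.closure (fiveTermRelators F)) :
    ξ ∈ AddSubgroup.closure (fiveTermRelators F) := by
  rw [← PreBloch.proj_eq_zero_iff] at hξ ⊢
  rw [map_nsmul] at hξ
  exact (nsmul_bijective_of_primeFactors_le_three hn h3).1 (by simpa using hξ)

end PreBloch

end Literature.NumberTheory.Transcendental
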